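import Mathlib
import Literature.Computability.AlgebraicComplexity.NewtonPolygonTauProofs

/-!
# Crux `NewtonTauWeak` (stmt-ValiantsHypothesis-5904), line `slope-ladder`: STUB 2 `stub_blocking`

The registered line `Cruxes/NewtonTauWeak/Lines/slope_ladder.lean` (forward ladder; re-registered 2026-08-27 with full
signatures) has three stubs; STUB 2 (`stub_blocking`, "M/L, provable now") is the `r`-block version of KPTT's proof of
Theorem 6 [KoiranPortierTavenasThomasse2015, §4]: a block convexity input — for some number of blocks `r ≥ 2` and some
`δ > 0`, every convexly independent subset of an `r`-fold Minkowski sum of planar `N`-sets has `≤ C (N+2)^{(2/3-δ) r}`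
points — gives the slope bound `vert(Σ_{i<k} Π_{j<m} f_ij) ≤ C' (k+2)^b 2^{bm} (t+2)^b (t+2)^{c m}` with
`c = 2/3 - min δ (1/3) < 2/3`.  Proof: partition `Fin m` into `r` blocks of `≤ q = ⌈m/r⌉` factors (block of `j` is
`⌊j/q⌋`), each block product is `(t+1)^q`-sparse, the hull vertices of `Σ_i Π_j f_ij` lying in the support of product
`i` lie in the `r`-fold sum of the embedded block supports and are convexly independent (extreme points of a convex set),
so there are `≤ C ((t+1)^q+2)^{(2/3-δ)r} ≤ C · 3^r (t+2)^r (t+2)^{c m}` of them per product (`q r ≤ m + r - 1`).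
This file proves the stub VERBATIM (statement written out over tree-visible constants, `open scoped Pointwise`).
The rung `BeatTwoThirds` is FRONTIER-disposition convex geometry and STUB 1 (`stub_blockConvexBound`, the [BBFKOTT10 §5]
problem `M_r(N)` for `r ≥ 4`) remains OPEN; nothing here bears on the crux `NewtonTauWeak` or on `VP ≠ VNP`.
-/

set_option linter.dupNamespace false

namespace Summit.ValiantsHypothesis.ValiantsHypothesis.Theorems.NewtonFramesNewtonTauWeak.SlopeLadderBlocking

open scoped BigOperators Pointwise
open MvPolynomial
open Literature.Computability.AlgebraicComplexity (newtonVertexCount)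
open Literature.Computability.AlgebraicComplexity.KPTT (card_support_prod_le)

noncomputable section

/-- The support of a finite product of multivariate polynomials lies in the pointwise sum of the supports
(iterating `MvPolynomial.support_mul`). [folklore] -/
theorem support_prod_subset_sum {K : Type*} [CommSemiring K] [Nontrivial K] {σ ι : Type*} [DecidableEq σ]
    [DecidableEq ι]
    (s : Finset ι) (g : ι → MvPolynomial σ K) :
    (∏ j ∈ s, g j).support ⊆ ∑ j ∈ s, (g j).support := by
  classical
  induction s using Finset.induction_on with
  | empty =>
    simp only [Finset.prod_empty, Finset.sum_empty]
    exact support_one.le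
  | insert a s ha ih =>
    rw [Finset.prod_insert ha, Finset.sum_insert ha]
    exact (support_mul _ _).trans (Finset.add_subset_add_left ih)

/-- A product over a finset of at most `q` factors, each `t`-sparse, is `(t+1)^q`-sparse. [folklore] -/
theorem card_support_prod_le_pow_succ {K : Type*} [CommSemiring K] [Nontrivial K] {σ ι : Type*} [DecidableEq σ]
    (s : Finset ι) (g : ι → MvPolynomial σ K) (t q : ℕ) (hg : ∀ j ∈ s, (g j).support.card ≤ t)
    (hs : s.card ≤ q) : (∏ j ∈ s, g j).support.card ≤ (t + 1) ^ q := by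
  classical
  calc (∏ j ∈ s, g j).support.card ≤ ∏ j ∈ s, (g j).support.card := card_support_prod_le _ _
    _ ≤ ∏ _j ∈ s, (t + 1) := Finset.prod_le_prod' fun j hj => (hg j hj).trans (Nat.le_succ t)
    _ = (t + 1) ^ s.card := by rw [Finset.prod_const]
    _ ≤ (t + 1) ^ q := Nat.pow_le_pow_right (Nat.succ_pos t) hs

/-- Block arithmetic: with `q = ⌈m/r⌉` (`r ≥ 1`), `q · r ≤ m + r - 1`, and every `j < m` has block index `j / q < r`. -/
theorem block_arith (m r : ℕ) (hr : 1 ≤ r) :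
    (m + r - 1) / r * r ≤ m + r - 1 ∧ ∀ j, j < m → j / ((m + r - 1) / r) < r := by
  refine ⟨Nat.div_mul_le_self _ _, fun j hj => ?_⟩
  set q := (m + r - 1) / r with hq
  have hq1 : 1 ≤ q := by
    rw [hq]; exact (Nat.le_div_iff_mul_le hr).mpr (by omega)
  have hmq : m ≤ q * r := by
    have h := Nat.lt_div_mul_add (a := m + r - 1) hr
    rw [← hq] at h
    have : m + r - 1 < q * r + r := h
    omega
  exact (Nat.div_lt_iff_lt_mul hq1).mpr (by nlinarith)

/-- Real-exponent bookkeeping: for `N = (t+1)^q` with `q r ≤ m + r - 1`, `0 ≤ c ≤ 1`, `1 ≤ r`: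
`((N:ℝ) + 2)^{c r} ≤ 3^r (t+2)^r (t+2)^{c m}`. [folklore] -/
theorem block_rpow_le (t q r m : ℕ) (c : ℝ) (hc0 : 0 ≤ c) (hc1 : c ≤ 1) (hr : 1 ≤ r) (hqr : q * r ≤ m + r - 1) :
    ((((t + 1) ^ q : ℕ) : ℝ) + 2) ^ (c * (r : ℝ)) ≤
      (3 : ℝ) ^ r * ((t : ℝ) + 2) ^ r * ((t : ℝ) + 2) ^ (c * (m : ℝ)) := by
  have ht2 : (1 : ℝ) ≤ (t : ℝ) + 2 := by have : (0:ℝ) ≤ t := Nat.cast_nonneg _; linarith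
  have ht0 : (0 : ℝ) ≤ (t : ℝ) + 2 := by linarith
  have hcr : 0 ≤ c * (r : ℝ) := by positivity
  -- (t+1)^q + 2 ≤ 3 (t+2)^q
  have hbase : (((t + 1) ^ q : ℕ) : ℝ) + 2 ≤ 3 * ((t : ℝ) + 2) ^ q := by
    have h1 : (((t + 1) ^ q : ℕ) : ℝ) ≤ ((t : ℝ) + 2) ^ q := by
      push_cast
      exact pow_le_pow_left₀ (by positivity) (by linarith) q
    have h2 : (1 : ℝ) ≤ ((t : ℝ) + 2) ^ q := one_le_pow₀ ht2
    linarith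
  have hN0 : (0 : ℝ) ≤ (((t + 1) ^ q : ℕ) : ℝ) + 2 := by positivity
  have hqr' : (q : ℝ) * r ≤ (m : ℝ) + r - 1 := by
    have hr' : ((q * r : ℕ) : ℝ) ≤ ((m + r - 1 : ℕ) : ℝ) := by exact_mod_cast hqr
    rw [Nat.cast_sub (by omega), Nat.cast_mul, Nat.cast_add, Nat.cast_one] at hr'
    exact hr'
  have hr0 : (0 : ℝ) ≤ r := Nat.cast_nonneg _
  have h3 : (3 : ℝ) ^ (c * (r : ℝ)) ≤ (3 : ℝ) ^ r := by
    rw [← Real.rpow_natCast (3 : ℝ) r]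
    exact Real.rpow_le_rpow_of_exponent_le (by norm_num) (by nlinarith)
  have hT : (((t : ℝ) + 2) ^ q) ^ (c * (r : ℝ)) = ((t : ℝ) + 2) ^ ((q : ℝ) * (c * (r : ℝ))) := by
    rw [← Real.rpow_natCast ((t : ℝ) + 2) q, ← Real.rpow_mul ht0]
  have hexp : ((t : ℝ) + 2) ^ ((q : ℝ) * (c * (r : ℝ))) ≤ ((t : ℝ) + 2) ^ (c * (m : ℝ) + (r : ℝ)) := by
    refine Real.rpow_le_rpow_of_exponent_le ht2 ?_
    nlinarith
  calc ((((t + 1) ^ q : ℕ) : ℝ) + 2) ^ (c * (r : ℝ))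
      ≤ (3 * ((t : ℝ) + 2) ^ q) ^ (c * (r : ℝ)) := Real.rpow_le_rpow hN0 hbase hcr
    _ = (3 : ℝ) ^ (c * (r : ℝ)) * (((t : ℝ) + 2) ^ q) ^ (c * (r : ℝ)) :=
        Real.mul_rpow (by norm_num) (by positivity)
    _ ≤ (3 : ℝ) ^ r * ((t : ℝ) + 2) ^ (c * (m : ℝ) + (r : ℝ)) := by
        rw [hT]
        exact mul_le_mul h3 hexp (by positivity) (by positivity)
    _ = (3 : ℝ) ^ r * ((t : ℝ) + 2) ^ r * ((t : ℝ) + 2) ^ (c * (m : ℝ)) := by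
        rw [Real.rpow_add (by linarith), Real.rpow_natCast]; ring

/-- **STUB 2 of line `slope-ladder` (`stub_blocking`), verbatim**: the block convexity input gives a slope `< 2/3`. -/
theorem stub_blocking :
    (∃ (r : ℕ) (δ C : ℝ), 2 ≤ r ∧ 0 < δ ∧
      ∀ (N : ℕ) (P : Fin r → Finset (Fin 2 → ℝ)) (S : Finset (Fin 2 → ℝ)),
        (∀ i, (P i).card ≤ N) → S ⊆ ∑ i, P i →
          ConvexIndependent ℝ (Subtype.val : ↥(S : Set (Fin 2 → ℝ)) → (Fin 2 → ℝ)) →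
            (S.card : ℝ) ≤ C * ((N : ℝ) + 2) ^ ((2 / 3 - δ) * (r : ℝ))) →
    ∃ c : ℝ, c < 2 / 3 ∧
      ∃ (C : ℝ) (b : ℕ), ∀ (k m t : ℕ) (f : Fin k → Fin m → MvPolynomial (Fin 2) ℂ),
        (∀ i j, (f i j).support.card ≤ t) →
          (Literature.Computability.AlgebraicComplexity.newtonVertexCount (∑ i, ∏ j, f i j) : ℝ) ≤
            C * ((k : ℝ) + 2) ^ b * 2 ^ (b * m) * ((t : ℝ) + 2) ^ b * ((t : ℝ) + 2) ^ (c * (m : ℝ)) := by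
  classical
  rintro ⟨r, δ, C₀, hr2, hδ, hH⟩
  set δ' : ℝ := min δ (1 / 3) with hδ'
  have hδ'pos : 0 < δ' := lt_min hδ (by norm_num)
  have hδ'le : δ' ≤ δ := min_le_left _ _
  have hδ'3 : δ' ≤ 1 / 3 := min_le_right _ _
  set c : ℝ := 2 / 3 - δ' with hc
  have hc0 : 0 ≤ c := by rw [hc]; linarith
  have hc1 : c ≤ 1 := by rw [hc]; linarith
  refine ⟨c, by rw [hc]; linarith, max C₀ 0 * (3 : ℝ) ^ r, r, fun k m t f hf => ?_⟩
  have hr1 : 1 ≤ r := by omega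
  -- blocks
  set q := (m + r - 1) / r with hq
  obtain ⟨hqr, hblk⟩ := block_arith m r hr1
  rw [← hq] at hqr hblk
  let blk : Fin m → Fin r := fun j => ⟨(j : ℕ) / q, hblk j j.isLt⟩
  -- block products and their supports
  set G : Fin k → Fin r → MvPolynomial (Fin 2) ℂ :=
    fun i b => ∏ j ∈ Finset.univ.filter (fun j : Fin m => blk j = b), f i j with hG
  have hprod : ∀ i, (∏ j, f i j) = ∏ b, G i b := by
    intro i
    rw [hG]
    exact (Finset.prod_fiberwise_of_maps_to (fun j _ => Finset.mem_univ (blk j)) (f i)).symm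
  have hblockcard : ∀ b : Fin r, (Finset.univ.filter (fun j : Fin m => blk j = b)).card ≤ q := by
    intro b
    -- the fibre of `b` injects into `[b q, b q + q)`
    have hsub : (Finset.univ.filter (fun j : Fin m => blk j = b)).image (fun j : Fin m => (j : ℕ)) ⊆
        Finset.Ico ((b : ℕ) * q) ((b : ℕ) * q + q) := by
      intro x hx
      obtain ⟨j, hj, rfl⟩ := Finset.mem_image.mp hx
      have hjb : (j : ℕ) / q = b := by
        have := (Finset.mem_filter.mp hj).2
        exact congrArg Fin.val this
      rw [Finset.mem_Ico]
      rcases Nat.eq_zero_or_pos q with hq0 | hq0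
      · exfalso
        have : (m + r - 1) / r = 0 := by rw [← hq, hq0]
        have hm : m + r - 1 < r := (Nat.div_eq_zero_iff_lt hr1 |>.mp this)  -- m = 0
        exact absurd j.isLt (by omega)
      · constructor
        · rw [← hjb]; exact Nat.div_mul_le_self _ _
        · rw [← hjb]
          have := Nat.lt_div_mul_add (a := (j : ℕ)) hq0
          linarith
    calc (Finset.univ.filter (fun j : Fin m => blk j = b)).card
        = ((Finset.univ.filter (fun j : Fin m => blk j = b)).image (fun j : Fin m => (j : ℕ))).card :=
          (Finset.card_image_of_injective _ Fin.val_injective).symm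
      _ ≤ (Finset.Ico ((b : ℕ) * q) ((b : ℕ) * q + q)).card := Finset.card_le_card hsub
      _ = q := by simp
  have hGt : ∀ i b, (G i b).support.card ≤ (t + 1) ^ q := fun i b =>
    card_support_prod_le_pow_succ _ _ t q (fun j _ => hf i j) (hblockcard b)
  -- the vertex count, as in `KPTT.theorem5_of_minkowski_convexIndependent_bound`
  dsimp only [newtonVertexCount]
  set ι : (Fin 2 →₀ ℕ) → (Fin 2 → ℝ) := fun e : Fin 2 →₀ ℕ => fun i : Fin 2 => ((e i : ℕ) : ℝ) with hι
  have hιadd : ∀ a a' : Fin 2 →₀ ℕ, ι (a + a') = ι a + ι a' := by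
    intro a a'; funext i; simp [hι]
  have hιzero : ι 0 = 0 := by funext i; simp [hι]
  let ιh : (Fin 2 →₀ ℕ) →+ (Fin 2 → ℝ) := { toFun := ι, map_zero' := hιzero, map_add' := hιadd }
  obtain ⟨F, hF⟩ : ∃ F : MvPolynomial (Fin 2) ℂ, ∑ i, ∏ j, f i j = F := ⟨_, rfl⟩
  rw [hF]
  set A : Finset (Fin 2 → ℝ) := F.support.image ι with hA
  set V : Set (Fin 2 → ℝ) := Set.extremePoints ℝ (convexHull ℝ (ι '' (F.support : Set _))) with hV
  have hAcoe : (A : Set (Fin 2 → ℝ)) = ι '' (F.support : Set _) := by rw [hA, Finset.coe_image]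
  have hVA : V ⊆ A := by rw [hAcoe]; exact extremePoints_convexHull_subset
  have hVci : ConvexIndependent ℝ (Subtype.val : V → (Fin 2 → ℝ)) :=
    (convex_convexHull ℝ _).convexIndependent_extremePoints
  set VF : Finset (Fin 2 → ℝ) := A.filter (· ∈ V) with hVF
  have hVFcoe : (VF : Set (Fin 2 → ℝ)) = V := by
    ext x
    simp only [hVF, Finset.coe_filter, Set.mem_setOf_eq]
    exact ⟨fun h => h.2, fun h => ⟨hVA h, h⟩⟩
  have hcount : V.ncard = VF.card := by rw [← hVFcoe, Set.ncard_coe_finset]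
  -- block supports `P i b`, and the vertices `W i` lying in product `i`
  set P : Fin k → Fin r → Finset (Fin 2 → ℝ) := fun i b => (G i b).support.image ι with hP
  set W : Fin k → Finset (Fin 2 → ℝ) := fun i => VF.filter (· ∈ ∑ b, P i b) with hW
  have hcover : VF ⊆ Finset.univ.biUnion W := by
    intro x hx
    have hxA : x ∈ A := (Finset.mem_filter.1 hx).1
    obtain ⟨e, he, rfl⟩ := Finset.mem_image.1 hxA
    rw [← hF] at he
    obtain ⟨i, -, hi⟩ := Finset.mem_biUnion.1 (MvPolynomial.support_sum he)
    rw [hprod i] at hi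
    have hsum := support_prod_subset_sum (Finset.univ : Finset (Fin r)) (G i) hi
    -- `e = Σ_b g b` with `g b ∈ supp (G i b)`
    have hmem : (e : Fin 2 →₀ ℕ) ∈ ((∑ b, (G i b).support : Finset (Fin 2 →₀ ℕ)) : Set (Fin 2 →₀ ℕ)) :=
      Finset.mem_coe.mpr hsum
    rw [Finset.coe_sum] at hmem
    obtain ⟨g, hg, hge⟩ := (Set.mem_fintype_sum _ _).mp hmem
    refine Finset.mem_biUnion.2 ⟨i, Finset.mem_univ _, Finset.mem_filter.2 ⟨hx, ?_⟩⟩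
    have hιe : ι e = ∑ b, ι (g b) := by rw [← hge]; exact map_sum ιh g Finset.univ
    rw [hιe, ← Finset.mem_coe, Finset.coe_sum]
    exact Set.finsetSum_mem_finsetSum _ _ _ fun b _ =>
      Finset.mem_coe.mpr (Finset.mem_image_of_mem _ (Finset.mem_coe.mp (hg b)))
  -- the block convexity input bounds each `W i`
  set N : ℕ := (t + 1) ^ q with hN
  have hN1 : (1 : ℝ) ≤ (N : ℝ) + 2 := by have : (0:ℝ) ≤ N := Nat.cast_nonneg _; linarith
  have hWle : ∀ i, ((W i).card : ℝ) ≤ max C₀ 0 * ((N : ℝ) + 2) ^ (c * (r : ℝ)) := by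
    intro i
    have hsub : W i ⊆ ∑ b, P i b := fun x hx => (Finset.mem_filter.1 hx).2
    have hci : ConvexIndependent ℝ
        (Subtype.val : ↥((W i : Finset (Fin 2 → ℝ)) : Set (Fin 2 → ℝ)) → (Fin 2 → ℝ)) := by
      refine hVci.mono fun x hx => ?_
      have hx' : x ∈ VF := (Finset.mem_filter.1 (Finset.mem_coe.1 hx)).1
      rw [← hVFcoe]
      exact Finset.mem_coe.2 hx'
    have hPN : ∀ b, (P i b).card ≤ N := fun b => Finset.card_image_le.trans (hGt i b)
    have h1 := hH N (P i) (W i) hPN hsub hci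
    have hX0 : (0 : ℝ) ≤ ((N : ℝ) + 2) ^ ((2 / 3 - δ) * (r : ℝ)) := Real.rpow_nonneg (by linarith) _
    calc ((W i).card : ℝ) ≤ C₀ * ((N : ℝ) + 2) ^ ((2 / 3 - δ) * (r : ℝ)) := h1
      _ ≤ max C₀ 0 * ((N : ℝ) + 2) ^ ((2 / 3 - δ) * (r : ℝ)) :=
          mul_le_mul_of_nonneg_right (le_max_left _ _) hX0
      _ ≤ max C₀ 0 * ((N : ℝ) + 2) ^ (c * (r : ℝ)) := by
          refine mul_le_mul_of_nonneg_left ?_ (le_max_right _ _)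
          refine Real.rpow_le_rpow_of_exponent_le hN1 ?_
          have hr0 : (0 : ℝ) ≤ r := Nat.cast_nonneg _
          rw [hc]; nlinarith
  have hsum : (VF.card : ℝ) ≤ ∑ i : Fin k, ((W i).card : ℝ) := by
    exact_mod_cast (Finset.card_le_card hcover).trans Finset.card_biUnion_le
  have hblock := block_rpow_le t q r m c hc0 hc1 hr1 hqr
  have hk : (k : ℝ) ≤ ((k : ℝ) + 2) ^ r := by
    calc (k : ℝ) ≤ (k : ℝ) + 2 := by linarith
      _ = ((k : ℝ) + 2) ^ 1 := (pow_one _).symm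
      _ ≤ ((k : ℝ) + 2) ^ r := pow_le_pow_right₀ (by have : (0:ℝ) ≤ k := Nat.cast_nonneg _; linarith) hr1
  have h2 : (1 : ℝ) ≤ 2 ^ (r * m) := one_le_pow₀ (by norm_num)
  have hC0 : 0 ≤ max C₀ 0 := le_max_right _ _
  have ht0 : (0 : ℝ) ≤ ((t : ℝ) + 2) ^ r * ((t : ℝ) + 2) ^ (c * (m : ℝ)) := by positivity
  calc (V.ncard : ℝ) = VF.card := by rw [hcount]
    _ ≤ ∑ i : Fin k, ((W i).card : ℝ) := hsum
    _ ≤ ∑ _i : Fin k, max C₀ 0 * ((N : ℝ) + 2) ^ (c * (r : ℝ)) := Finset.sum_le_sum fun i _ => hWle i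
    _ = k * (max C₀ 0 * ((N : ℝ) + 2) ^ (c * (r : ℝ))) := by
        rw [Finset.sum_const, Finset.card_univ, Fintype.card_fin, nsmul_eq_mul]
    _ ≤ k * (max C₀ 0 * ((3 : ℝ) ^ r * ((t : ℝ) + 2) ^ r * ((t : ℝ) + 2) ^ (c * (m : ℝ)))) := by
        have := mul_le_mul_of_nonneg_left hblock hC0
        exact mul_le_mul_of_nonneg_left this (Nat.cast_nonneg _)
    _ = max C₀ 0 * (3 : ℝ) ^ r * k * 1 * (((t : ℝ) + 2) ^ r * ((t : ℝ) + 2) ^ (c * (m : ℝ))) := by ring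
    _ ≤ max C₀ 0 * (3 : ℝ) ^ r * ((k : ℝ) + 2) ^ r * 2 ^ (r * m) *
          (((t : ℝ) + 2) ^ r * ((t : ℝ) + 2) ^ (c * (m : ℝ))) := by
        gcongr
    _ = max C₀ 0 * (3 : ℝ) ^ r * ((k : ℝ) + 2) ^ r * 2 ^ (r * m) * ((t : ℝ) + 2) ^ r *
          ((t : ℝ) + 2) ^ (c * (m : ℝ)) := by ring

end

end Summit.ValiantsHypothesis.ValiantsHypothesis.Theorems.NewtonFramesNewtonTauWeak.SlopeLadderBlocking
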